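import Mathlib
import Summits.CriticalPhenomena.PercolationContinuityZ3.Theorems.PercNearOneGluingNoHeavyLowerTailSpiderGluing
import HarnessLib

/-!
# `NoHeavyLowerTail` (stmt-CriticalPhenomena-4575) — Kozma–Nitzan Conjecture 3 on SPIDERS in `ε–δ` form

Support file (depth prover `prim-nh-dp-blobmono` gen 7, 2026-08-19; `--supports stmt-CriticalPhenomena-4575`).
No definitions, no named facts, no sorries.  Packages `SpiderGluing.spider_gluing` / `goodUnits_conjecture3` in the wording
of the crux `NearOneGluing`: for every `ε > 0` there is `δ > 0` (namely `min(ε/2, (ε/4)^4)`) such that for EVERY spider —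
observer `o ∉ A` whose non-relay neighbours start vertex-disjoint legs (injective chains of non-relays avoiding `o` whose
positive pairs towards non-relays go to chain neighbours; relay hairs arbitrary, so connector legs are allowed; any number of
legs, any lengths; `o` may also touch relays; relay side arbitrary) — `μ(o ↔ A) > 1 − δ` and `μ(a ↔ b) > 1 − δ` for all relays
imply `μ(o ↔ b) > 1 − ε`.  Uniform in the number of legs, their lengths, `|A|`, `n` and the weights.

* `spider_units` — the Steiner sets of a spider's legs satisfy the unit hypotheses of `goodUnits_gluing` (and the legs
  are good in `G − o` by `knGood_of_chain`);
* `spider_conjecture3` — the `ε–δ` statement above; `goodUnits_conjecture3_explicit`, `spider_conjecture3_explicit` —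
  the same with the explicit `δ_ε = min(ε/2, (ε/4)^4)` in the hypotheses (manifestly uniform in `n`).
-/

namespace Summit.CriticalPhenomena.PercolationContinuityZ3.Theorems

open MeasureTheory Set
open Literature.Probability.LatticeModels (prodBernoulli)
open Literature.Probability.Percolation

noncomputable section
open Classical

variable {n : ℕ}

namespace SpiderGluing

/-- **The legs of a spider are good units.**  From the leg data (`k`, `p`, chain and disjointness hypotheses) build the
Steiner sets `L x` (the vertex set of the leg of `x`, `∅` for relay neighbours) with all the structural properties used
by `goodUnits_gluing` / `goodUnits_conjecture3`, and Kozma–Nitzan goodness of every leg start in `G − o`. [this work] -/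
theorem spider_units (w : Sym2 (Fin n) → unitInterval) (A X : Finset (Fin n)) (hA : A.Nonempty)
    (o b : Fin n) (hb : b ∈ A)
    (k : Fin n → ℕ) (p : ∀ x : Fin n, Fin (k x + 1) → Fin n)
    (hp0 : ∀ x ∈ X, x ∉ A → p x 0 = x) (hpinj : ∀ x ∈ X, x ∉ A → Function.Injective (p x))
    (hpA : ∀ x ∈ X, x ∉ A → ∀ i, p x i ∉ A) (hpo : ∀ x ∈ X, x ∉ A → ∀ i, p x i ≠ o)
    (hchain : ∀ x ∈ X, x ∉ A → ∀ (i : Fin (k x + 1)) (u : Fin n), u ∉ A → u ≠ p x i → u ≠ o →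
      w s(p x i, u) ≠ 0 → ∃ l : Fin (k x + 1), u = p x l ∧ (l.val = i.val + 1 ∨ i.val = l.val + 1))
    (hlegs : ∀ x ∈ X, ∀ x' ∈ X, x ≠ x' → x ∉ A → x' ∉ A → ∀ i j, p x i ≠ p x' j) :
    ∃ L : Fin n → Finset (Fin n), (∀ x ∈ X, x ∉ A → x ∈ L x) ∧ (∀ x ∈ X, o ∉ L x) ∧
      (∀ x ∈ X, Disjoint (L x) A) ∧ (∀ x ∈ X, ∀ x' ∈ X, x ≠ x' → Disjoint (L x) (L x')) ∧
      (∀ x ∈ X, ∀ u ∈ L x, ∀ v, v ∉ L x → v ∉ A → v ≠ o → w s(u, v) = 0) ∧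
      (∀ x ∈ X, x ∉ A → KNGood (restrW (({o} : Set (Fin n))ᶜ) w) A hA x b) := by
  set L : Fin n → Finset (Fin n) := fun x =>
    if x ∈ A then ∅ else Finset.univ.filter (fun v => ∃ i, v = p x i) with hL
  have memL : ∀ x, x ∉ A → ∀ v, v ∈ L x ↔ ∃ i, v = p x i := by
    intro x hxA v
    simp [hL, hxA]
  have LA : ∀ x, x ∈ A → L x = ∅ := by
    intro x hxA
    simp [hL, hxA]
  refine ⟨L, ?_, ?_, ?_, ?_, ?_, ?_⟩
  · intro x hx hxA
    rw [memL x hxA]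
    exact ⟨0, (hp0 x hx hxA).symm⟩
  · intro x hx hoLx
    by_cases hxA : x ∈ A
    · rw [LA x hxA] at hoLx; simp at hoLx
    · obtain ⟨i, hi⟩ := (memL x hxA o).1 hoLx
      exact hpo x hx hxA i hi.symm
  · intro x hx
    by_cases hxA : x ∈ A
    · rw [LA x hxA]; exact Finset.disjoint_empty_left A
    · rw [Finset.disjoint_left]
      intro v hv hvA
      obtain ⟨i, rfl⟩ := (memL x hxA v).1 hv
      exact hpA x hx hxA i hvA
  · intro x hx x' hx' hxx'
    by_cases hxA : x ∈ A
    · rw [LA x hxA]; exact Finset.disjoint_empty_left _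
    by_cases hx'A : x' ∈ A
    · rw [LA x' hx'A]; exact Finset.disjoint_empty_right _
    rw [Finset.disjoint_left]
    intro v hv hv'
    obtain ⟨i, rfl⟩ := (memL x hxA v).1 hv
    obtain ⟨j, hj⟩ := (memL x' hx'A _).1 hv'
    exact hlegs x hx x' hx' hxx' hxA hx'A i j hj
  · intro x hx u hu v hvL hvA hvo
    by_cases hxA : x ∈ A
    · rw [LA x hxA] at hu; simp at hu
    · obtain ⟨i, rfl⟩ := (memL x hxA u).1 hu
      by_contra hne
      by_cases hvu : v = p x i
      · exact hvL ((memL x hxA v).2 ⟨i, hvu⟩)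
      · obtain ⟨l, rfl, _⟩ := hchain x hx hxA i v hvA hvu hvo hne
        exact hvL ((memL x hxA _).2 ⟨l, rfl⟩)
  · intro x hx hxA
    set w' := restrW (({o} : Set (Fin n))ᶜ) w with hw'
    have key := knGood_of_chain A hA b hb (k x) w' (p x) (hpinj x hx hxA) (hpA x hx hxA) ?_
    · rw [hp0 x hx hxA] at key
      exact key
    · intro i u huA hui hw0
      have huo : u ≠ o := by
        rintro rfl
        exact hw0 (restrW_apply_of_not_mem w fun h => (mk_mem_wireSet_iff.1 h).2.1 rfl)
      have hw0' : w s(p x i, u) ≠ 0 := fun h0 => hw0 (le_antisymm ((restrW_le _ w _).trans h0.le) bot_le)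
      exact hchain x hx hxA i u huA hui huo hw0'

/-- **Kozma–Nitzan Conjecture 3 on spiders, `ε–δ` form, uniform in the number and the length of the legs.**
For every `ε > 0`, with `δ = min(ε/2, (ε/4)^4)`: for every `n`, weights `w`, relays `A ∋ b`, observer `o ∉ A` whose
neighbours are the units `X ∌ o` (every `y ≠ o` with `w(o,y) ≠ 0` lies in `X`), and legs as in `spider_gluing`
(injective chains `p x` of non-relays from `p x 0 = x` avoiding `o`, positive pairs towards non-relays going to chain
neighbours, distinct legs disjoint; relay hairs arbitrary): if `μ(o ↔ A) > 1 − δ` and `μ(a ↔ b) > 1 − δ` for every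
`a ∈ A`, then `μ(o ↔ b) > 1 − ε`. [this work] -/
theorem spider_conjecture3 (ε : ℝ) (hε : 0 < ε) :
    ∃ δ : ℝ, 0 < δ ∧ ∀ (w : Sym2 (Fin n) → unitInterval) (A X : Finset (Fin n)) (o b : Fin n),
      o ∉ A → b ∈ A → o ∉ X → (∀ y, y ≠ o → w s(o, y) ≠ 0 → y ∈ X) →
      ∀ (k : Fin n → ℕ) (p : ∀ x : Fin n, Fin (k x + 1) → Fin n),
      (∀ x ∈ X, x ∉ A → p x 0 = x) → (∀ x ∈ X, x ∉ A → Function.Injective (p x)) →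
      (∀ x ∈ X, x ∉ A → ∀ i, p x i ∉ A) → (∀ x ∈ X, x ∉ A → ∀ i, p x i ≠ o) →
      (∀ x ∈ X, x ∉ A → ∀ (i : Fin (k x + 1)) (u : Fin n), u ∉ A → u ≠ p x i → u ≠ o →
        w s(p x i, u) ≠ 0 → ∃ l : Fin (k x + 1), u = p x l ∧ (l.val = i.val + 1 ∨ i.val = l.val + 1)) →
      (∀ x ∈ X, ∀ x' ∈ X, x ≠ x' → x ∉ A → x' ∉ A → ∀ i j, p x i ≠ p x' j) →
      1 - δ < (prodBernoulli w).real (⋃ a ∈ A, (openConn o a : Set (BondConfig (Fin n)))) →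
      (∀ a ∈ A, 1 - δ < (prodBernoulli w).real (openConn a b : Set (BondConfig (Fin n)))) →
      1 - ε < (prodBernoulli w).real (openConn o b : Set (BondConfig (Fin n))) := by
  obtain ⟨δ, hδ, hmain⟩ := goodUnits_conjecture3 (n := n) ε hε
  refine ⟨δ, hδ, ?_⟩
  intro w A X o b hoA hb hoX hX k p hp0 hpinj hpA hpo hchain hlegs hoA' hrel'
  have hA : A.Nonempty := ⟨b, hb⟩
  obtain ⟨L, hxL, hoL, hLA, hLL, hclos, hgood⟩ :=
    spider_units w A X hA o b hb k p hp0 hpinj hpA hpo hchain hlegs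
  exact hmain w A X hA o b hoA hb hoX hX L hxL hoL hLA hLL hclos hgood hoA' hrel'

/-- **Explicit-`δ` form, manifestly uniform in `n`**: for every `ε > 0` and EVERY `n`, weights, relay set and observer with
good units (as in `goodUnits_gluing`), `μ(o ↔ A) > 1 − δ_ε` and `μ(a ↔ b) > 1 − δ_ε` for all relays imply `μ(o ↔ b) > 1 − ε`,
where `δ_ε := min(ε/2, (ε/4)^4)` depends on `ε` alone. [this work] -/
theorem goodUnits_conjecture3_explicit (ε : ℝ) (hε : 0 < ε) (w : Sym2 (Fin n) → unitInterval)
    (A X : Finset (Fin n)) (hA : A.Nonempty) (o b : Fin n) (hoA : o ∉ A) (hb : b ∈ A) (hoX : o ∉ X)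
    (hX : ∀ y, y ≠ o → w s(o, y) ≠ 0 → y ∈ X)
    (L : Fin n → Finset (Fin n)) (hxL : ∀ x ∈ X, x ∉ A → x ∈ L x) (hoL : ∀ x ∈ X, o ∉ L x)
    (hLA : ∀ x ∈ X, Disjoint (L x) A) (hLL : ∀ x ∈ X, ∀ x' ∈ X, x ≠ x' → Disjoint (L x) (L x'))
    (hclos : ∀ x ∈ X, ∀ u ∈ L x, ∀ v, v ∉ L x → v ∉ A → v ≠ o → w s(u, v) = 0)
    (hgood : ∀ x ∈ X, x ∉ A → KNGood (restrW (({o} : Set (Fin n))ᶜ) w) A hA x b)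
    (hoA' : 1 - min (ε / 2) ((ε / 4) ^ 4) < (prodBernoulli w).real (⋃ a ∈ A, (openConn o a : Set (BondConfig (Fin n)))))
    (hrel' : ∀ a ∈ A, 1 - min (ε / 2) ((ε / 4) ^ 4) < (prodBernoulli w).real (openConn a b : Set (BondConfig (Fin n)))) :
    1 - ε < (prodBernoulli w).real (openConn o b : Set (BondConfig (Fin n))) := by
  set μ := prodBernoulli w with hμ
  set δ := min (ε / 2) ((ε / 4) ^ 4) with hδ
  have hδ1 : δ ≤ ε / 2 := min_le_left _ _
  have hδ2 : δ ≤ (ε / 4) ^ 4 := min_le_right _ _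
  have hc : ∀ S : Set (BondConfig (Fin n)), μ.real Sᶜ = 1 - μ.real S := fun S => by
    rw [measureReal_compl MeasurableSet.of_discrete, probReal_univ]
  have hrel : ∀ a ∈ A, μ.real (openConn a b : Set (BondConfig (Fin n)))ᶜ ≤ δ := by
    intro a ha; rw [hc]; linarith [hrel' a ha]
  have key := goodUnits_nearOneGluing w A X hA o b hoA hb hoX hX L hxL hoL hLA hLL hclos hgood δ hrel
  rw [hc, hc] at key
  have h4 : Real.sqrt (Real.sqrt δ) ≤ ε / 4 := sqrt_sqrt_le (by linarith) hδ2
  linarith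

/-- **Kozma–Nitzan Conjecture 3 on spiders, explicit `δ`, manifestly uniform in `n`, in the number of legs and in their
lengths**: for every `ε > 0`, with `δ_ε = min(ε/2, (ε/4)^4)`, every spider (leg data as in `spider_gluing`) with
`μ(o ↔ A) > 1 − δ_ε` and `μ(a ↔ b) > 1 − δ_ε` for all relays has `μ(o ↔ b) > 1 − ε`. [this work] -/
theorem spider_conjecture3_explicit (ε : ℝ) (hε : 0 < ε) (w : Sym2 (Fin n) → unitInterval)
    (A X : Finset (Fin n)) (o b : Fin n) (hoA : o ∉ A) (hb : b ∈ A) (hoX : o ∉ X)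
    (hX : ∀ y, y ≠ o → w s(o, y) ≠ 0 → y ∈ X)
    (k : Fin n → ℕ) (p : ∀ x : Fin n, Fin (k x + 1) → Fin n)
    (hp0 : ∀ x ∈ X, x ∉ A → p x 0 = x) (hpinj : ∀ x ∈ X, x ∉ A → Function.Injective (p x))
    (hpA : ∀ x ∈ X, x ∉ A → ∀ i, p x i ∉ A) (hpo : ∀ x ∈ X, x ∉ A → ∀ i, p x i ≠ o)
    (hchain : ∀ x ∈ X, x ∉ A → ∀ (i : Fin (k x + 1)) (u : Fin n), u ∉ A → u ≠ p x i → u ≠ o →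
      w s(p x i, u) ≠ 0 → ∃ l : Fin (k x + 1), u = p x l ∧ (l.val = i.val + 1 ∨ i.val = l.val + 1))
    (hlegs : ∀ x ∈ X, ∀ x' ∈ X, x ≠ x' → x ∉ A → x' ∉ A → ∀ i j, p x i ≠ p x' j)
    (hoA' : 1 - min (ε / 2) ((ε / 4) ^ 4) < (prodBernoulli w).real (⋃ a ∈ A, (openConn o a : Set (BondConfig (Fin n)))))
    (hrel' : ∀ a ∈ A, 1 - min (ε / 2) ((ε / 4) ^ 4) < (prodBernoulli w).real (openConn a b : Set (BondConfig (Fin n)))) :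
    1 - ε < (prodBernoulli w).real (openConn o b : Set (BondConfig (Fin n))) := by
  have hA : A.Nonempty := ⟨b, hb⟩
  obtain ⟨L, hxL, hoL, hLA, hLL, hclos, hgood⟩ :=
    spider_units w A X hA o b hb k p hp0 hpinj hpA hpo hchain hlegs
  exact goodUnits_conjecture3_explicit ε hε w A X hA o b hoA hb hoX hX L hxL hoL hLA hLL hclos hgood hoA' hrel'

end SpiderGluing

end

end Summit.CriticalPhenomena.PercolationContinuityZ3.Theorems
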